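import Mathlib
import HarnessLib
import Literature.Analysis.FluidPDE.LocalTypeI
import Summits.NavierStokesRegularity.NavierStokesRegularity.Theorems.PoloidalWindowDoorPoloidalWindowRigiditySubparabolicGradient

/-!
# `ImplosionDoor.TangentialCurlFreeTriviality` (stmt-NavierStokesRegularity-25306) — line `birth`,
# stub `stub_notSingularOfZero` PROVED: a profile vanishing on all negative slices is not backward singular

Registered stub of the skeleton of record `Cruxes/TangentialCurlFreeTriviality/Lines/birth` (planner ns-idea-6,
`TangentialCurlFreeTriviality_birth_g3.lean`, sha 988c162e…), VERBATIM, so the line's `sorry` at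
`stub_notSingularOfZero` closes by
`exact …Theorems.ImplosionDoorTangentialCurlFreeTrivialityStubNotSingularOfZero.stub_notSingularOfZero`.

PROOF.  `IsBackwardSingularPoint v 0` asks the essential sup of `‖v‖` over every backward parabolic cylinder
`(−r², 0) × B_r(0)` to be `∞`; a profile with `v(s,·) = 0` for all `s < 0` is bounded (by `0`) on `(−1, 0) × ℝ³`,
and the tree lemma `…SubparabolicGradient.not_backwardSingular_of_bounded_near` (bounded on a slab up to the apex ⇒
not backward singular) concludes.

HONEST FRAMING: a bookkeeping lemma about a HYPOTHETICAL blow-up profile (the trivial one); it is the closing step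
of a door-route crux (regularity CRITERION).  Nothing here bears on Navier–Stokes regularity; no summit statement
is proved.
-/

noncomputable section

-- the summit and its single sub-problem share the name (CONVENTIONS §1), as in every Theorems file
set_option linter.dupNamespace false

namespace Summit.NavierStokesRegularity.NavierStokesRegularity.Theorems.ImplosionDoorTangentialCurlFreeTrivialityStubNotSingularOfZero

open Set Function
open Literature.Analysis Literature.Analysis.FluidPDE
open Summit.NavierStokesRegularity.NavierStokesRegularity.Theorems.PoloidalWindowDoorPoloidalWindowRigiditySubparabolicGradient

/-- **Stub `stub_notSingularOfZero` of line `birth` (crux `TangentialCurlFreeTriviality`, stmt-25306), VERBATIM**: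
a profile `v` with `v(s,·) = 0` for every `s < 0` is not backward singular at the apex `(0,0)` — it is bounded
(by `0`) on the slab `(−1,0) × ℝ³`, and bounded-near-the-apex profiles are not backward singular
(`not_backwardSingular_of_bounded_near`). [folklore] -/
theorem stub_notSingularOfZero :
    ∀ (v : ℝ → EuclideanSpace ℝ (Fin 3) → EuclideanSpace ℝ (Fin 3)), (∀ s < 0, ∀ y, v s y = 0) →
      ¬ Literature.Analysis.FluidPDE.IsBackwardSingularPoint v 0 := by
  intro v hv
  refine not_backwardSingular_of_bounded_near (v := v) (t₁ := -1) (B := 0) (by norm_num) ?_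
  intro t ht x
  rw [hv t ht.2 x, norm_zero]

end Summit.NavierStokesRegularity.NavierStokesRegularity.Theorems.ImplosionDoorTangentialCurlFreeTrivialityStubNotSingularOfZero

end
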